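import Mathlib
import Summits.QuantumFields.YangMills.Theorems.TransportFieldFanoTorelonFloor
import HarnessLib

/-!
# Crux `TransportFieldFano.AdjointLoopDirichletWeak` ⟨stmt-QuantumFields-23362⟩, line `birth` (planner ym-idea-4 g17): the registered
# stub `stub_dWeightedPlaquetteMean` — CLOSED

The `d_x`-WEIGHTED TEMPORAL PLAQUETTE MEAN of the exact zero-flux vacuum (registered stub text `DWeightedPlaquetteMeanP`, verbatim) holds with
`k = 4`, `C = 1088 + 4(15 + 2/ε)`, `β₀ = 1`: it is ✓`dWeightedPlaquetteMean_of_logFloor` (the weighted lemma of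
✓`…TransportFieldFanoWeightedPlaquette`, no Harnack) fed with ✓`torelon_logFloor` — the torelon mean `E_{Ω²}[4 − (Re tr P₀)²] ≥ e^{−15}/β²`
of ✓`…TransportFieldFanoTorelonFloor` (one-link Harnack for `Ω = λ₀⁻¹K_βΩ`, fibrewise right-Haar invariance, Polyakov word surgery with the
diagonal pair `diag(e^{±i/(2β)})`).  With ✓`stub_kinematicChain` the birth composition `AdjointLoopDirichletWeak_of` now has no open input.
HONEST FRAMING: a fixed-lattice estimate on a support crux of a DRAFT line (the K2a uncertainty door); K2a, R2ξ″ and every rung are OPEN and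
the Yang–Mills mass gap is NOT proved.  No `sorry`, no new axiom; the `abbrev` is a registered-stub copy (verbatim), not a citable fact.
References: [cite: ReedSimonIV1978, Thm. XIII.43]; [cite: Luscher1983, §2].
-/

set_option autoImplicit false

noncomputable section

open MeasureTheory Filter Topology Real

namespace Summit.QuantumFields.YangMills.Theorems.TransportFieldFano

open Summit.QuantumFields.YangMills.Theorems.FemtoTransferGap

/-- The registered stub statement `DWeightedPlaquetteMeanP` of line `birth` of crux ⟨stmt-QuantumFields-23362⟩ (verbatim copy of the skeleton's
`BirthALD.DWeightedPlaquetteMeanP`; a registered-stub copy, not a citable fact). -/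
abbrev DWeightedPlaquetteMeanP : Prop :=
    ∃ k : ℝ, ∀ ε : ℝ, 0 < ε → ∃ C β₀ : ℝ, ∀ β : ℝ, β₀ ≤ β → ∀ (L : ℕ) [NeZero L], ∀ Ω : Literature.MathematicalPhysics.QuantumFieldTheory.GaugeConfig 3 L SU2 → ℝ, IsPhys Ω → l2 Ω Ω = 1 → transferApply β Ω = topValue su2Rep L β • Ω → let F : Literature.MathematicalPhysics.QuantumFieldTheory.GaugeConfig 3 L SU2 → ℝ := flowLift 0 (fun u : Literature.MathematicalPhysics.QuantumFieldTheory.GaugeConfig 3 1 SU2 => 4 - ((su2Rep (u ((0 : Literature.MathematicalPhysics.QuantumFieldTheory.Site 3 1), (0 : Fin 3)))).trace.re) ^ 2); ∀ x : Literature.MathematicalPhysics.QuantumFieldTheory.Site 3 L, ∀ j : ℕ, j < L → ∫ p, Ω p.1 * transferKernel su2Rep β p.1 p.2 * Ω p.2 * ((flowLiftAt x 0 (fun u : Literature.MathematicalPhysics.QuantumFieldTheory.GaugeConfig 3 1 SU2 => 4 - ((su2Rep (u ((0 : Literature.MathematicalPhysics.QuantumFieldTheory.Site 3 1), (0 : Fin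 3)))).trace.re) ^ 2) p.1 + flowLiftAt x 0 (fun u : Literature.MathematicalPhysics.QuantumFieldTheory.GaugeConfig 3 1 SU2 => 4 - ((su2Rep (u ((0 : Literature.MathematicalPhysics.QuantumFieldTheory.Site 3 1), (0 : Fin 3)))).trace.re) ^ 2) p.2) * (4 - 2 * (((p.1 ((fun z : Literature.MathematicalPhysics.QuantumFieldTheory.Site 3 L => z.shift 0)^[j] x, 0) * (p.2 ((fun z : Literature.MathematicalPhysics.QuantumFieldTheory.Site 3 L => z.shift 0)^[j] x, 0))⁻¹ : SU2) : Matrix (Fin 2) (Fin 2) ℂ).trace.re))) ∂(configMeasure SU2 L).prod (configMeasure SU2 L) ≤ C * β ^ (ε - 1) * (L : ℝ) ^ k * topValue su2Rep L β * l2 (fun U => F U * Ω U) Ω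

/-- ★★★ **`stub_dWeightedPlaquetteMean`** (registered stub of the birth skeleton of crux ⟨stmt-QuantumFields-23362⟩, signature
`DWeightedPlaquetteMeanP` verbatim): there is `k` (`= 4`) such that for every `ε > 0` there are `C, β₀` with, for `β ≥ β₀`, every `L`, every
`l2`-normalised physical eigenfunction `Ω` at `λ₀`, every site `x` and every link `x_j` of the `0`-loop through `x`,
`∫∫ Ω(U)K_β(U,V)Ω(V)(d_x(U)+d_x(V))(4 − 2Re tr U_{x_j}V_{x_j}⁻¹) ≤ C·β^(ε−1)·L^k·λ₀·E[FΩ²]`. [cite: ReedSimonIV1978, Thm. XIII.43] [cite: Luscher1983, §2] -/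
theorem stub_dWeightedPlaquetteMean : DWeightedPlaquetteMeanP :=
  dWeightedPlaquetteMean_of_logFloor torelon_logFloor

end Summit.QuantumFields.YangMills.Theorems.TransportFieldFano

end
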